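import Literature.Analysis.FluidPDE.KNSSLemma21Proof
import Literature.Analysis.FluidPDE.KNSSSwirlSupNonpos
import Literature.Analysis.FluidPDE.KNSSThm52OfWindow
import Literature.Analysis.FluidPDE.KNSSThm53Reduction
import HarnessLib

/-!
# KNSS 2009, Theorem 5.3: the swirl argument discharged; the target reduced to §4

Analysis/FluidPDE glue file (all results proved) on the decomposition path of the named fact
`Literature.Analysis.FluidPDE.KNSS2009_liouville_bound_C_over_r` (Koch–Nadirashvili–Seregin–
Šverák, *Liouville theorems for the Navier–Stokes equations and applications*, Acta Math. 203
(2009) = arXiv:0709.3599, **Theorem 5.3**: an axisymmetric bounded weak solution in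
`ℝ³ × (−∞, 0)` with `|u| ≤ C/r` vanishes).

With Lemma 2.1 now a theorem (`KNSS2009_lemma21_holds`, `KNSSLemma21Proof`), the core of the
printed proof of Theorem 5.3 — the scaling and cut-off argument (5.12)–(5.20) of p. 10, vendored
as the named fact `KNSS2009_swirl_sup_nonpos` and reduced to Lemma 2.1 in `KNSSSwirlSupNonpos` —
is discharged outright:

* `KNSS2009_swirl_sup_nonpos_holds : KNSS2009_swirl_sup_nonpos`.

Consequently the target rests on the §4 regularity inputs alone:

* `KNSS2009_liouville_bound_C_over_r_of_regularity`: Theorem 5.3 from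
  `KNSS2009_regularity_axisymmetric_swirl` (§4 with the swirl equation (5.10) for the
  axisymmetric representative) and Theorem 5.2 (`KNSS2009_liouville_axisymmetric_no_swirl`);
* `KNSS2009_liouville_bound_C_over_r_of_regularity_of_window`: the same with Theorem 5.2 replaced
  by its reduction to §4 on finite windows (`KNSS2009_liouville_axisymmetric_no_swirl_of_window`,
  `KNSSThm52OfWindow`), i.e. Theorem 5.3 from the two §4 facts
  `KNSS2009_regularity_axisymmetric_swirl` and `KNSS2009_regularity_boundedWeak_window`.

The same holds for the tree's rendering of Theorem 5.3 in the duality-form class of bounded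
ancient mild solutions, `Literature.Analysis.FluidPDE.knss_bound_C_over_r` (`SelfSimilarLiouville`),
through the proved bridge `knss_bound_C_over_r_of_KNSS2009` (`AncientMildRepresentative`: mild ⇒
bounded weak, weak-* continuity in time from the decay `r‖u‖ ≤ C`, jointly measurable
modification, a.e. `t` ⇒ every slice):

* `knss_bound_C_over_r_of_regularity`: the duality-form fact from
  `KNSS2009_regularity_axisymmetric_swirl` and Theorem 5.2;
* `knss_bound_C_over_r_of_regularity_of_window`: the duality-form fact from the two §4 facts
  `KNSS2009_regularity_axisymmetric_swirl` and `KNSS2009_regularity_boundedWeak_window` alone — so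
  its discharge `knss_bound_C_over_r_holds` is the one-line composition of these with the two
  `_holds` theorems of §4, once they exist (review of the decomposition, 2026-08-15: nothing
  specific to Theorem 5.3 remains to be proved; no further named fact is needed).

## References

* G. Koch, N. Nadirashvili, G. Seregin, V. Šverák, Acta Math. 203 (2009) 83–105 =
  arXiv:0709.3599: Theorem 5.3 and its proof (p. 10), Lemma 2.1 (p. 5), §4 (p. 8), Theorem 5.2
  (pp. 9–10). [KochNadirashviliSereginSverak2009]
-/

noncomputable section

namespace Literature.Analysis.FluidPDE

/-- **The scaling and cut-off argument of the proof of Theorem 5.3, discharged** (KNSS 2009,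
arXiv p. 10, (5.12)–(5.20): `sup f ≤ 0` for the swirl equation): the named fact
`KNSS2009_swirl_sup_nonpos` holds, by its reduction to Lemma 2.1
(`KNSS2009_swirl_sup_nonpos_of_lemma21`) and the theorem `KNSS2009_lemma21_holds`. [cite: KochNadirashviliSereginSverak2009, proof of Thm 5.3, (5.10)–(5.20) (arXiv p. 10)] -/
theorem KNSS2009_swirl_sup_nonpos_holds : KNSS2009_swirl_sup_nonpos :=
  KNSS2009_swirl_sup_nonpos_of_lemma21 (KNSS2009_lemma21_holds (EuclideanSpace ℝ (Fin 3)))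

/-- **KNSS 2009, Theorem 5.3, from the §4 regularity package and Theorem 5.2**: with Lemma 2.1
and the cut-off argument proved, the printed theorem follows from
`KNSS2009_regularity_axisymmetric_swirl` (§4 (4.6)–(4.8) with the swirl equation (5.10)) and
`KNSS2009_liouville_axisymmetric_no_swirl` (Theorem 5.2). [cite: KochNadirashviliSereginSverak2009, Thm 5.3 and its proof (arXiv p. 10)] -/
theorem KNSS2009_liouville_bound_C_over_r_of_regularity
    (hreg : KNSS2009_regularity_axisymmetric_swirl)
    (h52 : KNSS2009_liouville_axisymmetric_no_swirl) : KNSS2009_liouville_bound_C_over_r :=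
  KNSS2009_liouville_bound_C_over_r_of_lemma21 (KNSS2009_lemma21_holds (EuclideanSpace ℝ (Fin 3)))
    hreg h52

/-- **KNSS 2009, Theorem 5.3, from §4 alone**: the printed theorem follows from the two §4
facts `KNSS2009_regularity_axisymmetric_swirl` (§4 with (5.10) for the axisymmetric
representative) and `KNSS2009_regularity_boundedWeak_window` (§4 on finite windows, through
Theorem 5.2: `KNSS2009_liouville_axisymmetric_no_swirl_of_window`). [cite: KochNadirashviliSereginSverak2009, Thm 5.3 and its proof (arXiv p. 10), with Thm 5.2 (pp. 9–10) and §4 (p. 8)] -/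
theorem KNSS2009_liouville_bound_C_over_r_of_regularity_of_window
    (hreg : KNSS2009_regularity_axisymmetric_swirl)
    (hwin : KNSS2009_regularity_boundedWeak_window) : KNSS2009_liouville_bound_C_over_r :=
  KNSS2009_liouville_bound_C_over_r_of_regularity hreg
    (KNSS2009_liouville_axisymmetric_no_swirl_of_window hwin)

/-! ### The duality-form fact `knss_bound_C_over_r` reduced to §4 -/

/-- **The tree's duality-form Theorem 5.3 from the §4 regularity package and Theorem 5.2**:
`knss_bound_C_over_r` (KNSS 2009, Thm 5.3 rendered for bounded ancient mild solutions with
measurable slices, `SelfSimilarLiouville`) follows from `KNSS2009_regularity_axisymmetric_swirl`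
(§4 with the swirl equation (5.10)) and `KNSS2009_liouville_axisymmetric_no_swirl` (Theorem 5.2):
Lemma 2.1 (`KNSS2009_lemma21_holds`), the cut-off argument (`KNSS2009_swirl_sup_nonpos_holds`)
and the bridge to the duality-form class (`knss_bound_C_over_r_of_KNSS2009`, through
`knss_bound_C_over_r_of_facts`) are theorems. [cite: KochNadirashviliSereginSverak2009, Thm 5.3 and its proof (arXiv p. 10)] -/
theorem knss_bound_C_over_r_of_regularity
    (hreg : KNSS2009_regularity_axisymmetric_swirl)
    (h52 : KNSS2009_liouville_axisymmetric_no_swirl) : knss_bound_C_over_r :=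
  knss_bound_C_over_r_of_facts hreg KNSS2009_swirl_sup_nonpos_holds h52

/-- **The tree's duality-form Theorem 5.3 from §4 alone**: `knss_bound_C_over_r` follows from the
two §4 facts `KNSS2009_regularity_axisymmetric_swirl` and
`KNSS2009_regularity_boundedWeak_window` (the latter through Theorem 5.2,
`KNSS2009_liouville_axisymmetric_no_swirl_of_window`), via the printed theorem
(`KNSS2009_liouville_bound_C_over_r_of_regularity_of_window`) and the proved bridge
`knss_bound_C_over_r_of_KNSS2009`. Its discharge is therefore the composition of this theorem
with the discharges of the two §4 facts. [cite: KochNadirashviliSereginSverak2009, Thm 5.3 and its proof (arXiv p. 10), with Thm 5.2 (pp. 9–10) and §4 (p. 8)] -/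
theorem knss_bound_C_over_r_of_regularity_of_window
    (hreg : KNSS2009_regularity_axisymmetric_swirl)
    (hwin : KNSS2009_regularity_boundedWeak_window) : knss_bound_C_over_r :=
  knss_bound_C_over_r_of_KNSS2009
    (KNSS2009_liouville_bound_C_over_r_of_regularity_of_window hreg hwin)

end Literature.Analysis.FluidPDE

end
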